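import Summits.ValiantsHypothesis.ValiantsHypothesis.Theorems.OrderedCountWindowSegmentRank
import Literature.Computability.AlgebraicComplexity.NWDesignPolynomialVNP
import HarnessLib

/-!
# DegreeDial — normal form of sums of ordered set-multilinear ABPs, and the Reed–Solomon design tensor

Tools for the DEGREE DIAL (workshop lens 6, generation 9; the rung itself is
`DegreeDialDesignRung.lean`).

§1 A normal form for the layer-local ordered programs of `OrderedCountWindow.IsSumOrderedT`
(`compress`, `normalForm`): one reading layer per block, in a bijective order, no constant layers —
so that the segment-rank lemma `rank_setFlattening_le_of_hasOsmWidthLE` applies to every summand.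
§2 A flattening supported on the graph of a bijection between row words and column words has full
rank (`rank_setFlattening_of_graph`).  §3 The block-coefficient tensor of the design polynomial
`NW_{m+1,d,k}` (`Literature…NWDesignPolynomialVNP.nwDesign`) counts Reed–Solomon codewords
(`designTensor_eq_card`) and, by Vandermonde interpolation over the prime field `ZMod (m+1)`, every
balanced flattening of `NW_{m+1,2P,P}` is a permutation matrix of rank `(m+1)^P`
(`rank_setFlattening_designTensor`).

References: P. Chatterjee, D. Kush, S. Saraf, A. Shpilka, *Lower bounds for set-multilinear branching
programs*, CCC 2024 (LIPIcs 300, 20), §1.4, Def 3.2, Claim 3.3 [cite: ChatterjeeKushSarafShpilka2024];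
N. Kayal, C. Saha, R. Saptharishi, STOC 2014, §1 (the design polynomial)
[cite: KayalSahaSaptharishi2014, §1]; N. Nisan, A. Wigderson, JCSS 49 (1994), §2 (polynomial designs)
[cite: NisanWigderson1994, §2].
-/

set_option linter.dupNamespace false

noncomputable section

namespace Summit.ValiantsHypothesis.ValiantsHypothesis.Theorems.DegreeDial

open Literature.Computability.AlgebraicComplexity Matrix
open Summit.ValiantsHypothesis.ValiantsHypothesis.Theorems.OrderedCountWindow

variable {F : Type*} [Field F]


/-! ## §1 Layer compression: every layer-local ordered program has a normal form with one reading
layer per block and no constant layers -/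

/-- Compression of the layer matrices: the ordered product of all layers equals the ordered product of
one block-local matrix per READ block (in reading order) times a constant matrix. [folklore] -/
theorem compress_aux (L : ℕ) : ∀ {d n w : ℕ} (κ : Fin L → Option (Fin d))
    (C : Fin L → (Fin d → Fin n) → Matrix (Fin w) (Fin w) F),
    (∀ p j j', (∀ c, κ p = some c → j c = j' c) → C p j = C p j') →
    (∀ p p' c, κ p = some c → κ p' = some c → p = p') →
    ∃ (ρ : ℕ) (τ : Fin ρ → Fin d) (C' : Fin ρ → (Fin d → Fin n) → Matrix (Fin w) (Fin w) F)
      (K : Matrix (Fin w) (Fin w) F),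
      Function.Injective τ ∧ (∀ c, (∃ s, τ s = c) ↔ ∃ p, κ p = some c) ∧
      (∀ s j j', j (τ s) = j' (τ s) → C' s j = C' s j') ∧
      ∀ j, (List.ofFn fun p => C p j).prod = (List.ofFn fun s => C' s j).prod * K := by
  induction L with
  | zero =>
    intro d n w κ C hC hinj
    refine ⟨0, Fin.elim0, fun s => Fin.elim0 s, 1, fun s => Fin.elim0 s, fun c => ?_,
      fun s => Fin.elim0 s, fun j => by simp⟩
    simp
  | succ L ih =>
    intro d n w κ C hC hinj
    classical
    obtain ⟨ρ, τ, C', K, hτ, hrange, hloc, hprod⟩ := ih (fun p => κ p.castSucc)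
      (fun p => C p.castSucc) (fun p j j' h => hC p.castSucc j j' h)
      (fun p p' c h h' => Fin.castSucc_injective _ (hinj _ _ c h h'))
    have hsplit : ∀ j, (List.ofFn fun p : Fin (L + 1) => C p j).prod =
        (List.ofFn fun s => C' s j).prod * K * C (Fin.last L) j := by
      intro j
      rw [List.ofFn_succ', List.concat_eq_append, List.prod_append, List.prod_singleton, hprod j]
    rcases hlast : κ (Fin.last L) with _ | c₀
    · -- the last layer is constant: fold it into `K`
      let K' : Matrix (Fin w) (Fin w) F :=
        if h : Nonempty (Fin d → Fin n) then K * C (Fin.last L) h.some else K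
      refine ⟨ρ, τ, C', K', hτ, fun c => ?_, hloc, fun j => ?_⟩
      · rw [hrange c, Fin.exists_fin_succ', hlast]
        simp
      · have hne : Nonempty (Fin d → Fin n) := ⟨j⟩
        have hKj : K' = K * C (Fin.last L) j := by
          simp only [K', dif_pos hne]
          rw [hC (Fin.last L) hne.some j (fun c hc => by simp [hlast] at hc)]
        rw [hsplit j, hKj, Matrix.mul_assoc]
    · -- the last layer reads block `c₀`: append it (times `K`) as a new local layer
      have hc₀ : ∀ s, τ s ≠ c₀ := by
        intro s hs
        obtain ⟨p, hp⟩ := (hrange c₀).1 ⟨s, hs⟩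
        have := hinj p.castSucc (Fin.last L) c₀ hp hlast
        exact (Fin.castSucc_lt_last p).ne this
      let τ' : Fin (ρ + 1) → Fin d := Fin.snoc τ c₀
      let C'' : Fin (ρ + 1) → (Fin d → Fin n) → Matrix (Fin w) (Fin w) F :=
        Fin.snoc C' fun j => K * C (Fin.last L) j
      have hτ'c : ∀ i : Fin ρ, τ' i.castSucc = τ i := fun i => by simp [τ']
      have hτ'l : τ' (Fin.last ρ) = c₀ := by simp [τ']
      have hC''c : ∀ i : Fin ρ, C'' i.castSucc = C' i := fun i => by simp [C'']
      have hC''l : C'' (Fin.last ρ) = fun j => K * C (Fin.last L) j := by simp [C'']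
      refine ⟨ρ + 1, τ', C'', 1, ?_, fun c => ?_, ?_, fun j => ?_⟩
      · intro s s' h
        induction s using Fin.lastCases with
        | last =>
          induction s' using Fin.lastCases with
          | last => rfl
          | cast i => rw [hτ'l, hτ'c] at h; exact absurd h.symm (hc₀ i)
        | cast i =>
          induction s' using Fin.lastCases with
          | last => rw [hτ'l, hτ'c] at h; exact absurd h (hc₀ i)
          | cast i' => rw [hτ'c, hτ'c] at h; rw [hτ h]
      · rw [Fin.exists_fin_succ', Fin.exists_fin_succ', hlast, hτ'l, ← hrange c]
        simp only [hτ'c, Option.some.injEq]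
      · intro s j j' h
        induction s using Fin.lastCases with
        | last =>
          rw [hC''l]
          rw [hτ'l] at h
          show K * C (Fin.last L) j = K * C (Fin.last L) j'
          rw [hC (Fin.last L) j j' (fun c hc => by rw [hlast, Option.some.injEq] at hc; rw [← hc]; exact h)]
        | cast i =>
          rw [hC''c]
          rw [hτ'c] at h
          exact hloc i j j' h
      · rw [hsplit j, Matrix.mul_one, List.ofFn_succ', List.concat_eq_append, List.prod_append,
          List.prod_singleton, hC''l]
        simp only [hC''c]
        rw [Matrix.mul_assoc]

/-- **Normal form of one program**: a layer-local ordered program reading every block exactly once is a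
program with exactly one layer per block, read in a bijective order, and no constant layers.
[cite: ChatterjeeKushSarafShpilka2024, §1.4 (ordered smABPs as ROABPs in the block variables)] -/
theorem compress {L d n w : ℕ} {κ : Fin L → Option (Fin d)} {T : (Fin d → Fin n) → F}
    (hT : HasOsmWidthLE w κ T) (hκ : ∀ c, ∃! p, κ p = some c) :
    ∃ τ : Fin d → Fin d, Function.Bijective τ ∧ HasOsmWidthLE w (fun p => some (τ p)) T := by
  obtain ⟨C, u, v, hC, hTj⟩ := hT
  obtain ⟨ρ, τ, C', K, hτ, hrange, hloc, hprod⟩ := compress_aux L κ C hC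
    (fun p p' c h h' => (hκ c).unique h h')
  have hsurj : Function.Surjective τ := fun c => (hrange c).2 (hκ c).exists
  have hbij : Function.Bijective τ := ⟨hτ, hsurj⟩
  have hρ : ρ = d := by simpa using Fintype.card_congr (Equiv.ofBijective τ hbij)
  subst hρ
  exact ⟨τ, hbij, C', u, K *ᵥ v, fun s j j' h => hloc s j j' (h (τ s) rfl),
    fun j => by rw [hTj j, hprod j, ← Matrix.mulVec_mulVec]⟩

/-- **Normal form of a sum of ordered programs.**
[cite: ChatterjeeKushSarafShpilka2024, §1.1 (sums of ordered smABPs, total width)] -/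
theorem normalForm {d n t W : ℕ} {T : (Fin d → Fin n) → F} (h : IsSumOrderedT t W T) :
    ∃ (τ : Fin t → Fin d → Fin d) (w : Fin t → ℕ) (B : Fin t → (Fin d → Fin n) → F),
      (∀ i, Function.Bijective (τ i)) ∧ (∀ i, HasOsmWidthLE (w i) (fun p => some (τ i p)) (B i)) ∧
        ∑ i, w i ≤ W ∧ ∀ j, ∑ i, B i j = T j := by
  obtain ⟨L, κ, w, B, hκ, hB, hsum, hT⟩ := h
  choose τ hτ hprog using fun i => compress (hB i) (hκ i)
  exact ⟨τ, w, B, hτ, hprog, hsum, hT⟩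


/-! ## §2 A flattening supported on the graph of a bijection has full rank -/

/-- If `D (glueWord S x y) ≠ 0` exactly when `y = f x` for a bijection `f` from row words to column
words, the flattening of `D` across `S` is a unit diagonal matrix times a permutation matrix, so its
rank is the number of column words. [folklore; cf. ChatterjeeKushSarafShpilka2024, Claim 3.3] -/
theorem rank_setFlattening_of_graph {N n : ℕ} (S : Finset (Fin N)) (D : (Fin N → Fin n) → F)
    (f : ({c // c ∈ S} → Fin n) ≃ ({c // c ∉ S} → Fin n))
    (h0 : ∀ x y, f x ≠ y → D (glueWord S x y) = 0) (h1 : ∀ x, D (glueWord S x (f x)) ≠ 0) :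
    (setFlattening S D).rank = n ^ Fintype.card {c // c ∉ S} := by
  classical
  let dcol : ({c // c ∉ S} → Fin n) → F := fun y => D (glueWord S (f.symm y) y)
  have hM : setFlattening S D = (Matrix.diagonal dcol).submatrix f id := by
    ext x y
    simp only [setFlattening_apply, Matrix.submatrix_apply, Matrix.diagonal_apply, id_eq]
    by_cases hxy : f x = y
    · rw [if_pos hxy]
      subst hxy
      simp only [dcol, Equiv.symm_apply_apply]
    · rw [if_neg hxy]
      exact h0 _ _ hxy
  have hunit : IsUnit (Matrix.diagonal dcol) := by
    rw [Matrix.isUnit_diagonal, Pi.isUnit_iff]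
    intro y
    have := h1 (f.symm y)
    rw [Equiv.apply_symm_apply] at this
    exact isUnit_iff_ne_zero.mpr this
  rw [hM, show (Matrix.diagonal dcol).submatrix ⇑f id =
      (Matrix.diagonal dcol).submatrix ⇑f ⇑(Equiv.refl _) from rfl, Matrix.rank_submatrix,
    Matrix.rank_of_isUnit _ hunit, Fintype.card_fun, Fintype.card_fin]

/-! ## §3 The Reed–Solomon design tensor: codeword counting and the MDS property -/

section Design

variable {m : ℕ}

/-- Evaluation of a word exponent vector at a variable. -/
theorem wordFinsupp_apply {d : ℕ} {α : Type*} [DecidableEq α] (v : Fin d → α) (i : Fin d) (a : α) :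
    (∑ i' : Fin d, Finsupp.single (⟨i', v i'⟩ : Σ _ : Fin d, α) 1) ⟨i, a⟩ =
      if v i = a then 1 else 0 := by
  rw [Finsupp.finsetSum_apply]
  rw [Finset.sum_eq_single i]
  · simp only [Finsupp.single_apply, Sigma.mk.inj_iff, heq_eq_eq, true_and]
  · intro i' _ hi'
    rw [Finsupp.single_apply, if_neg]
    intro h
    exact hi' (Sigma.mk.inj_iff.1 h).1
  · simp

/-- Word exponent vectors determine the word. -/
theorem wordFinsupp_inj {d : ℕ} {α : Type*} [DecidableEq α] (v v' : Fin d → α) :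
    (∑ i : Fin d, Finsupp.single (⟨i, v i⟩ : Σ _ : Fin d, α) 1) =
        ∑ i : Fin d, Finsupp.single (⟨i, v' i⟩ : Σ _ : Fin d, α) 1 ↔ v = v' := by
  constructor
  · intro h
    funext i
    have := congrArg (fun e => e ⟨i, v i⟩) h
    simp only [wordFinsupp_apply, if_true] at this
    by_contra hne
    rw [if_neg (Ne.symm hne)] at this
    exact one_ne_zero this
  · rintro rfl
    rfl

/-- The design polynomial is the sum of the word monomials of the Reed–Solomon evaluation words.
[cite: ChatterjeeKushSarafShpilka2024, Def 3.2] -/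
theorem nwDesign_eq_sum_monomial (m d k : ℕ) :
    nwDesign (m + 1) d k = ∑ cf : Fin k → ZMod (m + 1), MvPolynomial.monomial
      (∑ i : Fin d, Finsupp.single
        (⟨i, ∑ l : Fin k, cf l * ((i : ℕ) : ZMod (m + 1)) ^ (l : ℕ)⟩ : Σ _ : Fin d, ZMod (m + 1)) 1) 1 := by
  unfold nwDesign
  refine Finset.sum_congr rfl fun cf _ => ?_
  rw [MvPolynomial.monomial_sum_index, MvPolynomial.C_1, one_mul]
  refine Finset.prod_congr rfl fun i _ => ?_
  rw [← pow_one (MvPolynomial.X _), MvPolynomial.X_pow_eq_monomial]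

/-- **The design tensor counts codewords**: entry `j` of the block-coefficient tensor of `NW_{m+1,d,k}`
is the number of coefficient vectors whose evaluation word is `j`.
[cite: ChatterjeeKushSarafShpilka2024, Def 3.2; KayalSahaSaptharishi2014, §1] (cf. the same count for
the route SRC's cut matrices, `StableRankCancellationDesign.coeffMat_designPoly`) -/
theorem designTensor_eq_card {d k : ℕ} (j : Fin d → Fin (m + 1)) :
    MvPolynomial.coeff
        (∑ i : Fin d, Finsupp.single (⟨i, (j i : ZMod (m + 1))⟩ : Σ _ : Fin d, ZMod (m + 1)) 1)
        (nwDesign (m + 1) d k) =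
      ((Finset.univ.filter fun cf : Fin k → ZMod (m + 1) =>
        ∀ i : Fin d, ∑ l : Fin k, cf l * ((i : ℕ) : ZMod (m + 1)) ^ (l : ℕ) = (j i : ZMod (m + 1))).card :
        ℂ) := by
  classical
  rw [nwDesign_eq_sum_monomial, MvPolynomial.coeff_sum]
  simp_rw [MvPolynomial.coeff_monomial, wordFinsupp_inj, Finset.sum_boole]
  congr 2
  ext cf
  simp only [Finset.mem_filter, Finset.mem_univ, true_and, funext_iff]

/-- Distinct blocks `i < d ≤ m+1` have distinct evaluation points in `ZMod (m+1)`. -/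
theorem point_injective {d : ℕ} (hd : d ≤ m + 1) :
    Function.Injective fun i : Fin d => ((i : ℕ) : ZMod (m + 1)) := by
  intro i i' h
  have h' := congrArg ZMod.val h
  simp only [ZMod.val_cast_of_lt (lt_of_lt_of_le i.2 hd),
    ZMod.val_cast_of_lt (lt_of_lt_of_le i'.2 hd)] at h'
  exact Fin.ext h'

/-- **MDS / interpolation**: over the prime field `ZMod (m+1)`, a coefficient vector of length `k` is
determined by the values of its evaluation word on any `k` blocks (Vandermonde). [folklore] -/
theorem rsEval_restrict_injective {d k : ℕ} (hp : (m + 1).Prime) (hd : d ≤ m + 1) {ι : Type*}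
    [Fintype ι] (pt : ι → Fin d) (hpt : Function.Injective pt) (hk : Fintype.card ι = k) :
    Function.Injective fun cf : Fin k → ZMod (m + 1) => fun a : ι =>
      ∑ l : Fin k, cf l * (((pt a : Fin d) : ℕ) : ZMod (m + 1)) ^ (l : ℕ) := by
  classical
  haveI : Fact (m + 1).Prime := ⟨hp⟩
  let e : Fin k ≃ ι := (Fintype.equivFinOfCardEq hk).symm
  let v : Fin k → ZMod (m + 1) := fun a => ((pt (e a) : ℕ) : ZMod (m + 1))
  have hv : Function.Injective v := (point_injective hd).comp (hpt.comp e.injective)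
  have hdet : IsUnit (Matrix.vandermonde v) := by
    rw [Matrix.isUnit_iff_isUnit_det, isUnit_iff_ne_zero]
    exact Matrix.det_vandermonde_ne_zero_iff.2 hv
  have hmv : Function.Injective (Matrix.vandermonde v).mulVec :=
    Matrix.mulVec_injective_iff_isUnit.2 hdet
  intro cf cf' h
  apply hmv
  funext a
  have := congrFun h (e a)
  simp only at this
  simp only [Matrix.mulVec, dotProduct, Matrix.vandermonde_apply, v]
  simpa only [mul_comm] using this

/-- Row words: evaluation words restricted to `S` (`|S| = k`) are in bijection with coefficient
vectors. -/
theorem rsEval_rows_bijective {d k : ℕ} (hp : (m + 1).Prime) (hd : d ≤ m + 1)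
    (S : Finset (Fin d)) (hS : S.card = k) :
    Function.Bijective fun cf : Fin k → ZMod (m + 1) => fun x : {c // c ∈ S} =>
      ∑ l : Fin k, cf l * (((x.1 : Fin d) : ℕ) : ZMod (m + 1)) ^ (l : ℕ) := by
  classical
  rw [Fintype.bijective_iff_injective_and_card]
  refine ⟨rsEval_restrict_injective hp hd Subtype.val Subtype.val_injective (by simp [hS]), ?_⟩
  simp [ZMod.card, hS]

/-- **Full rank of the balanced flattenings of the design tensor** (`d = 2P` blocks, `k = P`, `|S| = P`):
the flattening is a permutation matrix, of rank `(m+1)^P`.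
[cite: ChatterjeeKushSarafShpilka2024, Claim 3.3 (interpolation: a unique extension of every row
monomial)] -/
theorem rank_setFlattening_designTensor {P : ℕ} (hp : (m + 1).Prime) (hd : P + P ≤ m + 1)
    (S : Finset (Fin (P + P))) (hS : S.card = P) :
    (setFlattening S fun j : Fin (P + P) → Fin (m + 1) =>
        MvPolynomial.coeff
          (∑ i : Fin (P + P),
            Finsupp.single (⟨i, (j i : ZMod (m + 1))⟩ : Σ _ : Fin (P + P), ZMod (m + 1)) 1)
          (nwDesign (m + 1) (P + P) P)).rank = (m + 1) ^ P := by
  classical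
  have hSc : Fintype.card {c // c ∉ S} = P := by
    rw [Fintype.card_subtype_compl, Fintype.card_coe, hS, Fintype.card_fin]
    omega
  -- rows ≃ coefficient vectors
  let ρ : (Fin P → ZMod (m + 1)) → ({c // c ∈ S} → Fin (m + 1)) :=
    fun cf x => ∑ l : Fin P, cf l * (((x.1 : Fin (P + P)) : ℕ) : ZMod (m + 1)) ^ (l : ℕ)
  have hρ : Function.Bijective ρ := rsEval_rows_bijective hp hd S hS
  let eρ := Equiv.ofBijective ρ hρ
  -- coefficient vectors ↪ column words
  let γ : (Fin P → ZMod (m + 1)) → ({c // c ∉ S} → Fin (m + 1)) :=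
    fun cf y => ∑ l : Fin P, cf l * (((y.1 : Fin (P + P)) : ℕ) : ZMod (m + 1)) ^ (l : ℕ)
  have hγ : Function.Injective γ :=
    rsEval_restrict_injective hp hd Subtype.val Subtype.val_injective hSc
  let f₀ : ({c // c ∈ S} → Fin (m + 1)) → ({c // c ∉ S} → Fin (m + 1)) := fun x => γ (eρ.symm x)
  have hf₀ : Function.Bijective f₀ := by
    rw [Fintype.bijective_iff_injective_and_card]
    refine ⟨hγ.comp eρ.symm.injective, ?_⟩
    simp [hS, hSc]
  let f := Equiv.ofBijective f₀ hf₀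
  -- the fibre over `glueWord S x y` is `{eρ.symm x}` if `y = f x` and empty otherwise
  have hfib : ∀ x y (cf : Fin P → ZMod (m + 1)),
      (∀ i : Fin (P + P), ∑ l : Fin P, cf l * ((i : ℕ) : ZMod (m + 1)) ^ (l : ℕ) =
        (glueWord S x y i : ZMod (m + 1))) → cf = eρ.symm x ∧ f x = y := by
    intro x y cf h
    have hx : ρ cf = x := by
      funext s
      have := h s.1
      rw [glueWord_of_mem S x y s.2] at this
      exact this
    have hcf : cf = eρ.symm x := by
      rw [Equiv.eq_symm_apply]; exact hx
    refine ⟨hcf, ?_⟩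
    funext c'
    have := h c'.1
    rw [glueWord_of_not_mem S x y c'.2] at this
    rw [← this]
    show γ (eρ.symm x) c' = _
    rw [← hcf]
    rfl
  refine (rank_setFlattening_of_graph S _ f ?_ ?_).trans (by rw [hSc])
  · intro x y hxy
    rw [designTensor_eq_card, Nat.cast_eq_zero, Finset.card_eq_zero, Finset.filter_eq_empty_iff]
    intro cf _ h
    exact hxy (hfib x y cf h).2
  · intro x
    rw [designTensor_eq_card, Nat.cast_ne_zero, Finset.card_ne_zero]
    refine ⟨eρ.symm x, Finset.mem_filter.2 ⟨Finset.mem_univ _, fun i => ?_⟩⟩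
    by_cases hi : i ∈ S
    · rw [glueWord_of_mem S _ _ hi]
      have h := congrFun (eρ.apply_symm_apply x) ⟨i, hi⟩
      rw [Equiv.ofBijective_apply] at h
      exact h
    · rw [glueWord_of_not_mem S _ _ hi]
      rfl

end Design


end Summit.ValiantsHypothesis.ValiantsHypothesis.Theorems.DegreeDial

end
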